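/-
Copyright (c) 2026 the pub-hodgecm-mathlib formalisation cell (harness21).  Prover seat hodgecm-mathlib-K2E3-p14 (g3), HCML Track B «K2-LIT» (build stream 29),
h413 = `stmt-HodgeConjecture-24833`, line `K2_E3_EllipticInputs`, unit U12 «Characters», socket #11 road (11-SC), letter (SC-an), END-GAME MAP v1 (line lead K2E3-p20 (g3),
deal [M2a] BY NAME `K2/STATUS.md` 2026-09-04T02:14:17Z): brick [M2a] FILE B «THE CARTAN DICHOTOMY AND THE SUPPORT DATUM OF THE SUPERCUSPIDAL SLICE ON THE ONE-PLACE
MODEL `U(σ_w, Φ₃)(L_w)`».  2026-09-04.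
-/
import Summits.HodgeConjecture.HodgeConjecture.Theorems.K2E3SupercuspModelFrameAtPlace        -- ★ [M2a] FILE A (this seat): `isCompact_center_of_eq_over`, `placeForm_qsForm_eq_over`, instances; brings ★ `localNonsplitEquiv`, GL instances
import Summits.HodgeConjecture.HodgeConjecture.Theorems.F0P3cStCharTSEllCartanCompact         -- ★ `exists_conj_cmTorus_of_not_isCompact_centralizer` (a non-compact Cartan of `U(Φ₃)(L⁺_v)` is conjugate to `M`)
import Summits.HodgeConjecture.HodgeConjecture.Theorems.K2E3UnipotentConjTwistBochner          -- ★ p856617 `exists_isCompact_subset_mul_of_isCompact_image_mk` (Lemma 14's output read as `supp ⊆ C·T`)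
import Summits.HodgeConjecture.HodgeConjecture.Theorems.F0P3cStCharTSWeylHypFibre              -- ★ `isUnit_sub_of_isRegularElt_glDiagonal`
import Literature.NumberTheory.Automorphic.CMLocalNonsplitBorelTransport                      -- ★ `localNonsplitEquiv_mem_torusU_iff` (torus ↔ torus through the one-place model)
import Literature.NumberTheory.Rogawski1990.RegularOrbitalIntegralLocallyConstantCM           -- ★ `isRegularElt_iff_charpoly_separable_localNonsplitEquiv`
import Literature.NumberTheory.Automorphic.ConjugationProperOnRegularCompactaLocal              -- ★ model-level Lemma 14 `UnitaryGroupOfForm.isCompact_image_mk_setOf_exists_conj_mem_of_charpoly_separable`; ★ `forall_apply_mem_centralizer_singleton_iff_of_eq`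
import Literature.NumberTheory.Automorphic.RegularDiagonalCentralizer                          -- ★ `mem_torusU_iff_mem_centralizer_of_isUnit_sub` (`Z(t) = T` for regular diagonal `t`)
import Literature.NumberTheory.Automorphic.AdmissibleInvariantFormSchur                        -- ★ `IsSupercuspidal.hasCompactSupport_sesqForm_apply_apply`
import HarnessLib

/-!
# h413 ∕ Track B «K2-LIT», line `K2_E3_EllipticInputs`, unit U12, road (11-SC), letter (SC-an) — brick [M2a], FILE B: THE CARTAN DICHOTOMY AND THE SUPPORT DATUM OF
# THE SUPERCUSPIDAL SLICE ON THE ONE-PLACE MODEL `U(σ_w, Φ₃)(L_w)` (Rogawski 1990, §3.6, §12.5; Harish-Chandra 1970, Part I §3 Lemma 14, Part VII §2 (i))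

Cell `pub/hodgecm-mathlib`, crux H413 = `stmt-HodgeConjecture-24833`, route of record `HCCMUnconditional`; chair K2-lead (g0), dealer K2E3-plan (g2), line lead of the
(SC-an) END-GAME MAP K2E3-p20 (g3).  THEOREMS ONLY (no `def`, no `instance`, no `notation`, no named-fact hypothesis, no `sorry`); lane
`--supports stmt-HodgeConjecture-24833 --as helper`, count-neutral.  Sequel of ★ FILE A `K2E3SupercuspModelFrameAtPlace` (items (a)(b)(c)(e)); here items (d) and (f) of the deal.

SETTING.  `K := L_w = w.1.adicCompletion L` at a place `w ∣ v` fixed by complex conjugation (`v` non-split), `σ := σ_w`, `J = Φ₃` in the generic currency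
`{J} (hJ : J = (StdForm.antidiagonal 3).over L_w)`, `U := U(σ_w, J)(L_w)`, `T := torusU σ_w J` (diagonal torus).
* §1 (d) **THE CARTAN DICHOTOMY AT THE MODEL** `exists_conj_torusU_of_not_isCompact_centralizer`: a REGULAR `g ∈ U` whose centraliser is NOT compact is `g = y t y⁻¹` with
  `t = diag d ∈ T` regular, and `Z(g) = y T y⁻¹` (membership-wise `h ∈ Z(g) ↔ y⁻¹ h y ∈ T`) — ★ `exists_conj_cmTorus_of_not_isCompact_centralizer` on `U(Φ₃)(L⁺_v)` (types (1)–(3)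
  of [Rogawski1990 §3.6] are compact; type (0) is `M`) transported along ★ `localNonsplitEquiv` (regularity ★ `isRegularElt_iff_charpoly_separable_localNonsplitEquiv`, torus ★
  `localNonsplitEquiv_mem_torusU_iff`, centralisers ★ `forall_apply_mem_centralizer_singleton_iff_of_eq`).  So for the (SC-an) assembly every regular NON-ELLIPTIC `g` is
  `y t y⁻¹` with `t` regular diagonal — the shape ★ [M1] ∕ ★ [M3] ∕ (T20-e) are written for.
* §2 (f) **THE SUPPORT DATUM OF THE SUPERCUSPIDAL SLICE AT THE MODEL** `exists_isCompact_support_coeff_conj_subset_mul_torusU`: for `ρ` smooth supercuspidal on `U` with a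
  `U`-invariant sesquilinear `B`, and `t = diag d` regular: `∃ C` compact with `B u′ (ρ (x t x⁻¹) u) ≠ 0 ⇒ x ∈ C·T` — Harish-Chandra's Lemma 14 at the model (★
  `UnitaryGroupOfForm.isCompact_image_mk_setOf_exists_conj_mem_of_charpoly_separable` at `K = {t}`, `C = tsupport θ`; `θ` compactly supported by ★
  `IsSupercuspidal.hasCompactSupport_sesqForm_apply_apply` and the compact centre ★ FILE A `isCompact_center_of_eq_over`), read through ★ `exists_isCompact_subset_mul_of_isCompact_image_mk`
  and `Z(t) = T` (★ `mem_torusU_iff_mem_centralizer_of_isUnit_sub`, ★ `isUnit_sub_of_isRegularElt_glDiagonal`) — print's `(i) Supp f ⊂ C·A` for `f_t`, the `hsupp` of ★ [M3]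
  `cuspForm_cancellation_U3` (the field-model twin of ★ p856655 `K2E3SupercuspOrbitalSliceCuspidal.exists_isCompact_support_coeff_conj_subset_mul_torusU`).

HONEST LABEL.  HC_CM is proved only modulo the 7 printed citations (2 remaining named inputs: hLiu418 = `stmt-HodgeConjecture-24832`, h413 = `stmt-HodgeConjecture-24833`)
until rung 0 closes; this file is a count-neutral helper (place-level plumbing; nothing printed is asserted as a fact).

## References
* [Rogawski1990] J. D. Rogawski, *Automorphic Representations of Unitary Groups in Three Variables*, Ann. of Math. Stud. 123 (1990), §3.6 pp. 28–31 (Cartan subgroups of `U(3)`: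
  type (0) = `M`, types (1)–(3) compact modulo the centre), §4.9 p. 54, §12.5 pp. 182–184.
* [HarishChandra1970] Harish-Chandra (notes by G. van Dijk), *Harmonic Analysis on Reductive p-adic Groups*, LNM 162 (1970), Part I §3 Lemma 14 p. 9; Part VII §2 p. 70 (i).
* [PlatonovRapinchuk1994] V. Platonov, A. Rapinchuk, *Algebraic Groups and Number Theory* (1994), §2.3, §5.1.
-/

set_option autoImplicit false
set_option linter.dupNamespace false  -- the mandated namespace repeats the single-problem summit's segment (`HodgeConjecture.HodgeConjecture`)

noncomputable section

open NumberField IsDedekindDomain MeasureTheory Measure Filter Topology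
open Literature.NumberTheory.Automorphic Literature.NumberTheory.Automorphic.UnitaryGroup Literature.NumberTheory.GaloisRepresentations
open Literature.NumberTheory.Rogawski1990 ValuativeRel
open scoped Matrix MatrixGroups Pointwise

namespace Summit.HodgeConjecture.HodgeConjecture.Cruxes.H413.K2E3SupercuspModelFrameAtPlaceCartan

variable (L : Type) [Field L] [NumberField L] [IsCMField L] {v : HeightOneSpectrum (𝓞 ↥(maximalRealSubfield L))}
  (w : PlacesOver L v) (hw : IsCMField.complexConj L • w.1 = w.1)

/-! ## §1 (d) The Cartan dichotomy at the model: a regular element with non-compact centraliser is conjugate into the diagonal torus -/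

set_option maxHeartbeats 800000 in
-- `isDefEq` across the two spellings of the carrier (`«local» L c 3 Φ₃ v` vs `U(c ⊗ 1, cmLocalForm)`) in the final rewrites; same class and value as ★
-- `F0P3cStCharTSEllCartanCompact.exists_conj_cmTorus_of_not_isCompact_centralizer`'s own `maxHeartbeats 800000`
/-- **THE CARTAN DICHOTOMY ON `U(σ_w, Φ₃)(L_w)`.**  For `g ∈ U = U(σ_w, J)(L_w)`, `J = Φ₃`, REGULAR (separable characteristic polynomial, ★ `IsRegularElt`) with NON-COMPACT
centraliser: `g = y t y⁻¹` with `t = diag d ∈ T` regular, and `h ∈ Z(g) ↔ y⁻¹ h y ∈ T` — transport of ★ `exists_conj_cmTorus_of_not_isCompact_centralizer` (`U(Φ₃)(L⁺_v)`, `v`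
non-split: the Cartan subgroups of types (1)–(3) are compact, type (0) is the diagonal `M`) along the one-place model ★ `localNonsplitEquiv`.
[cite: Rogawski1990, §3.6 pp. 28–31; §12.5 pp. 182, 184] [cite: PlatonovRapinchuk1994, §5.1] -/
theorem exists_conj_torusU_of_not_isCompact_centralizer {J : Matrix (Fin 3) (Fin 3) (w.1.adicCompletion L)}
    (hJ : J = (StdForm.antidiagonal 3).over (w.1.adicCompletion L))
    {g : ↥(unitaryGroupOfForm (galAdicCompletionMap (L := L) (IsCMField.complexConj L) hw) J)}
    (hreg : IsRegularElt (g : GL (Fin 3) (w.1.adicCompletion L)))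
    (hnc : ¬ IsCompact ((Subgroup.centralizer ({g} : Set ↥(unitaryGroupOfForm (galAdicCompletionMap (L := L) (IsCMField.complexConj L) hw) J)) :
      Subgroup ↥(unitaryGroupOfForm (galAdicCompletionMap (L := L) (IsCMField.complexConj L) hw) J)) :
        Set ↥(unitaryGroupOfForm (galAdicCompletionMap (L := L) (IsCMField.complexConj L) hw) J))) :
    ∃ (y t : ↥(unitaryGroupOfForm (galAdicCompletionMap (L := L) (IsCMField.complexConj L) hw) J)) (d : Fin 3 → (w.1.adicCompletion L)ˣ),
      glDiagonal 3 (w.1.adicCompletion L) d = (t : GL (Fin 3) (w.1.adicCompletion L)) ∧ IsRegularElt (t : GL (Fin 3) (w.1.adicCompletion L)) ∧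
      g = y * t * y⁻¹ ∧
      ∀ h : ↥(unitaryGroupOfForm (galAdicCompletionMap (L := L) (IsCMField.complexConj L) hw) J),
        h ∈ Subgroup.centralizer ({g} : Set ↥(unitaryGroupOfForm (galAdicCompletionMap (L := L) (IsCMField.complexConj L) hw) J)) ↔
          y⁻¹ * h * y ∈ torusU (galAdicCompletionMap (L := L) (IsCMField.complexConj L) hw) J := by
  obtain rfl : J = placeForm (qsForm L) w.1 := hJ.trans (K2E3SupercuspModelFrameAtPlace.placeForm_qsForm_eq_over L w).symm
  have hns : ∀ w' : PlacesOver L v, IsCMField.complexConj L • w'.1 = w'.1 := fun w' => by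
    haveI := PlacesOver.subsingleton_of_smul_eq (IsCMField.complexConj L) (IsCMField.complexConj_ne_one L) w hw
    rw [Subsingleton.elim w' w]; exact hw
  set e := localNonsplitEquiv (IsCMField.complexConj L) (qsForm L) (IsCMField.complexConj_ne_one L) w hw with he
  -- `γ₀ := e⁻¹ g` on `U(Φ₃)(L⁺_v)`: regular, with non-compact centraliser
  set γ₀ := e.symm g with hγ₀
  have heγ₀ : e γ₀ = g := e.apply_symm_apply g
  have hreg₀ : IsRegularElt ((γ₀ : «local» L (IsCMField.complexConj L) 3 (qsForm L) v) : GL (Fin 3) (LocalRing L v)) := by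
    refine (isRegularElt_iff_charpoly_separable_localNonsplitEquiv (IsCMField.complexConj L) 3 (qsForm L) (IsCMField.complexConj_ne_one L) w hw γ₀).2 ?_
    rw [← he, heγ₀]
    exact hreg
  -- centralisers correspond along `e` (`e γ₀ = g`)
  have key : ∀ h₀ : «local» L (IsCMField.complexConj L) 3 (qsForm L) v,
      e h₀ ∈ Subgroup.centralizer ({g} : Set _) ↔ h₀ ∈ Subgroup.centralizer ({γ₀} : Set («local» L (IsCMField.complexConj L) 3 (qsForm L) v)) :=
    fun h₀ => Literature.MeasureTheory.Group.forall_apply_mem_centralizer_singleton_iff_of_eq e.toMulEquiv heγ₀ h₀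
  have key' : ∀ h, h ∈ Subgroup.centralizer ({g} : Set _) ↔ e.symm h ∈ Subgroup.centralizer ({γ₀} : Set («local» L (IsCMField.complexConj L) 3 (qsForm L) v)) := by
    intro h
    have h1 := key (e.symm h)
    rwa [ContinuousMulEquiv.apply_symm_apply] at h1
  have hZimage : (e : «local» L (IsCMField.complexConj L) 3 (qsForm L) v → _) ''
      ((Subgroup.centralizer ({γ₀} : Set («local» L (IsCMField.complexConj L) 3 (qsForm L) v)) : Subgroup _) : Set _) =
      ((Subgroup.centralizer ({g} : Set _) : Subgroup _) : Set _) := by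
    ext h
    constructor
    · rintro ⟨h₀, hh₀, rfl⟩
      exact (key h₀).2 hh₀
    · intro hh
      exact ⟨e.symm h, (key' h).1 hh, e.apply_symm_apply h⟩
  have hnc₀ : ¬ IsCompact ((Subgroup.centralizer ({γ₀} : Set («local» L (IsCMField.complexConj L) 3 (qsForm L) v)) :
      Subgroup («local» L (IsCMField.complexConj L) 3 (qsForm L) v)) : Set («local» L (IsCMField.complexConj L) 3 (qsForm L) v)) := by
    intro hc
    apply hnc
    rw [← hZimage]
    exact hc.image (show Continuous (e : «local» L (IsCMField.complexConj L) 3 (qsForm L) v → _) from e.continuous)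
  -- the CM Cartan dichotomy
  obtain ⟨x, m, hmreg, hconj, hZ⟩ := F0P3cStCharTSEllCartanCompact.exists_conj_cmTorus_of_not_isCompact_centralizer L (v := v) hns (γ₀ := γ₀) hreg₀ hnc₀
  -- respell the CM data on the one-place carrier `«local» L c 3 Φ₃ v` (definitionally the same topological group)
  set x' : «local» L (IsCMField.complexConj L) 3 (qsForm L) v := x with hx'
  set m' : «local» L (IsCMField.complexConj L) 3 (qsForm L) v :=
    (m : ↥(unitaryGroupOfForm (conjLocal L (IsCMField.complexConj L) v) (cmLocalForm L 3 v))) with hm'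
  have hconj' : x' * m' * x'⁻¹ = γ₀ := hconj
  have hZ' : ∀ h₀ : «local» L (IsCMField.complexConj L) 3 (qsForm L) v,
      h₀ ∈ Subgroup.centralizer ({γ₀} : Set («local» L (IsCMField.complexConj L) 3 (qsForm L) v)) ↔ x'⁻¹ * h₀ * x' ∈ (cmBorelTriple L 3 v).M :=
    fun h₀ => hZ h₀
  -- transport back: `y := e x`, `t := e m`
  have htT : e m' ∈ torusU (galAdicCompletionMap (L := L) (IsCMField.complexConj L) hw) (placeForm (qsForm L) w.1) :=
    (localNonsplitEquiv_mem_torusU_iff L v w hw m').2 m.2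
  obtain ⟨d, hd⟩ := (mem_torusU_iff _).1 htT
  have htreg : IsRegularElt (((e m') :
      ↥(unitaryGroupOfForm (galAdicCompletionMap (L := L) (IsCMField.complexConj L) hw) (placeForm (qsForm L) w.1))) : GL (Fin 3) (w.1.adicCompletion L)) :=
    (isRegularElt_iff_charpoly_separable_localNonsplitEquiv (IsCMField.complexConj L) 3 (qsForm L) (IsCMField.complexConj_ne_one L) w hw m').1 hmreg
  refine ⟨e x', e m', d, hd, htreg, ?_, fun h => ?_⟩
  · rw [← heγ₀, ← hconj', map_mul, map_mul, map_inv]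
  · -- `h ∈ Z(g) ↔ e⁻¹ h ∈ Z(γ₀) ↔ x⁻¹ (e⁻¹ h) x ∈ M ↔ e(x⁻¹ (e⁻¹ h) x) = y⁻¹ h y ∈ T`
    rw [key' h, hZ' (e.symm h), ← localNonsplitEquiv_mem_torusU_iff L v w hw (x'⁻¹ * e.symm h * x'), ← he, map_mul, map_mul, map_inv,
      ContinuousMulEquiv.apply_symm_apply]

/-! ## §2 (f) The support datum of the supercuspidal slice at the model -/

set_option synthInstance.maxHeartbeats 400000 in
set_option maxHeartbeats 1600000 in
-- instance-term unification on the model carriers (same class as ★ [M1] `K2E3SupercuspOrbitalSliceCuspidalModel`)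
/-- **(Φ_C (i), support `⊆ C·T`) ON THE MODEL `U(σ_w, Φ₃)(L_w)`** for `θ = B u′ (ρ(·) u)` a supercuspidal coefficient (`ρ` smooth supercuspidal — NO irreducibility —, `B`
`U`-invariant; compact support by ★ `IsSupercuspidal.hasCompactSupport_sesqForm_apply_apply` and the compact centre ★ FILE A `isCompact_center_of_eq_over`) and `t = diag d`
REGULAR: `∃ C` compact with `f_t(x) ≠ 0 ⇒ x ∈ C·T` — Harish-Chandra's Lemma 14 at the model (★ `UnitaryGroupOfForm.isCompact_image_mk_setOf_exists_conj_mem_of_charpoly_separable`,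
`E = L_w` normed by ★ `Valued.toNontriviallyNormedField`, `K = {t}`, `C = tsupport θ`), read through ★ `exists_isCompact_subset_mul_of_isCompact_image_mk` and `Z(t) = T`
(★ `mem_torusU_iff_mem_centralizer_of_isUnit_sub`).  The `hsupp` of ★ [M3] `cuspForm_cancellation_U3` for `f := f_t`.
[cite: HarishChandra1970, Part I §3 Lemma 14 p. 9; Part VII §2 p. 70 (i)] [cite: Rogawski1990, §4.9 p. 54] -/
theorem exists_isCompact_support_coeff_conj_subset_mul_torusU {J : Matrix (Fin 3) (Fin 3) (w.1.adicCompletion L)}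
    (hJ : J = (StdForm.antidiagonal 3).over (w.1.adicCompletion L))
    {V : Type*} [AddCommGroup V] [Module ℂ V]
    (ρ : Representation ℂ ↥(unitaryGroupOfForm (galAdicCompletionMap (L := L) (IsCMField.complexConj L) hw) J) V) (hsm : ρ.IsSmooth) (hsc : ρ.IsSupercuspidal)
    (B : V →ₗ⋆[ℂ] V →ₗ[ℂ] ℂ)
    (hBinv : ∀ (g : ↥(unitaryGroupOfForm (galAdicCompletionMap (L := L) (IsCMField.complexConj L) hw) J)) (x y : V), B (ρ g x) (ρ g y) = B x y)
    (t : ↥(unitaryGroupOfForm (galAdicCompletionMap (L := L) (IsCMField.complexConj L) hw) J)) {d : Fin 3 → (w.1.adicCompletion L)ˣ}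
    (hd : glDiagonal 3 (w.1.adicCompletion L) d = (t : GL (Fin 3) (w.1.adicCompletion L))) (hreg : IsRegularElt (t : GL (Fin 3) (w.1.adicCompletion L)))
    (u u' : V) :
    ∃ C : Set ↥(unitaryGroupOfForm (galAdicCompletionMap (L := L) (IsCMField.complexConj L) hw) J), IsCompact C ∧
      ∀ x : ↥(unitaryGroupOfForm (galAdicCompletionMap (L := L) (IsCMField.complexConj L) hw) J), B u' (ρ (x * t * x⁻¹) u) ≠ 0 →
        x ∈ C * (torusU (galAdicCompletionMap (L := L) (IsCMField.complexConj L) hw) J :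
          Set ↥(unitaryGroupOfForm (galAdicCompletionMap (L := L) (IsCMField.complexConj L) hw) J)) := by
  have hZc := K2E3SupercuspModelFrameAtPlace.isCompact_center_of_eq_over L w hw hJ
  subst hJ
  letI : NontriviallyNormedField (w.1.adicCompletion L) := Valued.toNontriviallyNormedField (w.1.adicCompletion L) (WithZero (Multiplicative ℤ))
  haveI : CharZero (w.1.adicCompletion L) := charZero_of_injective_algebraMap (algebraMap L (w.1.adicCompletion L)).injective
  haveI : LocallyCompactSpace (GL (Fin 3) (w.1.adicCompletion L)) := locallyCompactSpace_gl_adicCompletion L 3 w.1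
  haveI : SecondCountableTopology (GL (Fin 3) (w.1.adicCompletion L)) := secondCountableTopology_gl_adicCompletion L 3 w.1
  haveI : SigmaCompactSpace (GL (Fin 3) (w.1.adicCompletion L)) := sigmaCompactSpace_of_locallyCompact_secondCountable
  haveI : LocallyCompactSpace ↥(unitaryGroupOfForm (galAdicCompletionMap (L := L) (IsCMField.complexConj L) hw) ((StdForm.antidiagonal 3).over (w.1.adicCompletion L))) :=
    K2E3SupercuspModelFrameAtPlace.locallyCompactSpace_unitaryGroupOfForm_adicCompletion L w hw _
  have hσc : Continuous (galAdicCompletionMap (L := L) (IsCMField.complexConj L) hw) := continuous_galAdicCompletionMap L (IsCMField.complexConj L) hw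
  have hσσ : ∀ x, galAdicCompletionMap (L := L) (IsCMField.complexConj L) hw (galAdicCompletionMap (L := L) (IsCMField.complexConj L) hw x) = x :=
    galAdicCompletionMap_galAdicCompletionMap_of_smul_eq (IsCMField.complexConj L) w (IsCMField.complexConj_ne_one L) hw
  have hreg' : IsRegularElt (glDiagonal 3 (w.1.adicCompletion L) d) := by rw [hd]; exact hreg
  -- the coefficient has compact support (compact centre)
  have hθ : HasCompactSupport fun g : ↥(unitaryGroupOfForm (galAdicCompletionMap (L := L) (IsCMField.complexConj L) hw)
      ((StdForm.antidiagonal 3).over (w.1.adicCompletion L))) => B u' (ρ g u) :=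
    hsc.hasCompactSupport_sesqForm_apply_apply hZc hsm hBinv u u'
  -- Harish-Chandra's Lemma 14 at the model, `K = {t}`, `C = tsupport θ`
  have hA := UnitaryGroupOfForm.isCompact_image_mk_setOf_exists_conj_mem_of_charpoly_separable (m := 3) two_ne_zero hσc hσσ
    (K2E3SupercuspModelFrameAtPlace.over_three_hermitian (galAdicCompletionMap (L := L) (IsCMField.complexConj L) hw))
    K2E3SupercuspModelFrameAtPlace.isUnit_det_over_three t hreg isCompact_singleton
    (Set.singleton_subset_iff.2 (Subgroup.mem_centralizer_singleton_iff.2 rfl)) (fun t' ht' => by rw [Set.mem_singleton_iff.1 ht']; exact hreg) hθ.isCompact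
  have hS : IsCompact ((QuotientGroup.mk : ↥(unitaryGroupOfForm (galAdicCompletionMap (L := L) (IsCMField.complexConj L) hw) ((StdForm.antidiagonal 3).over (w.1.adicCompletion L))) →
      ↥(unitaryGroupOfForm (galAdicCompletionMap (L := L) (IsCMField.complexConj L) hw) ((StdForm.antidiagonal 3).over (w.1.adicCompletion L))) ⧸
        Subgroup.centralizer ({t} : Set _)) ''
      {x | x * t * x⁻¹ ∈ tsupport fun g : ↥(unitaryGroupOfForm (galAdicCompletionMap (L := L) (IsCMField.complexConj L) hw)
        ((StdForm.antidiagonal 3).over (w.1.adicCompletion L))) => B u' (ρ g u)}) := by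
    have hset : {x : ↥(unitaryGroupOfForm (galAdicCompletionMap (L := L) (IsCMField.complexConj L) hw) ((StdForm.antidiagonal 3).over (w.1.adicCompletion L))) |
        ∃ t' ∈ ({t} : Set _), x * t' * x⁻¹ ∈ tsupport fun g : ↥(unitaryGroupOfForm (galAdicCompletionMap (L := L) (IsCMField.complexConj L) hw)
          ((StdForm.antidiagonal 3).over (w.1.adicCompletion L))) => B u' (ρ g u)} =
        {x | x * t * x⁻¹ ∈ tsupport fun g : ↥(unitaryGroupOfForm (galAdicCompletionMap (L := L) (IsCMField.complexConj L) hw)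
          ((StdForm.antidiagonal 3).over (w.1.adicCompletion L))) => B u' (ρ g u)} := by
      ext x; simp only [Set.mem_setOf_eq, Set.mem_singleton_iff, exists_eq_left]
    rw [← hset]; exact hA
  obtain ⟨C, hC, hsub⟩ := K2E3UnipotentConjTwistBochner.exists_isCompact_subset_mul_of_isCompact_image_mk (Subgroup.centralizer {t}) hS
  have hT : torusU (galAdicCompletionMap (L := L) (IsCMField.complexConj L) hw) ((StdForm.antidiagonal 3).over (w.1.adicCompletion L)) =
      Subgroup.centralizer ({t} : Set _) :=
    Subgroup.ext fun g => mem_torusU_iff_mem_centralizer_of_isUnit_sub hd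
      (fun i j hij => F0P3cStCharTSWeylHypFibre.isUnit_sub_of_isRegularElt_glDiagonal hreg' hij) g
  refine ⟨C, hC, fun x hx => ?_⟩
  rw [hT]
  exact hsub (subset_tsupport _ (Function.mem_support.2 hx))

end Summit.HodgeConjecture.HodgeConjecture.Cruxes.H413.K2E3SupercuspModelFrameAtPlaceCartan

end
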